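import Literature.Computability.Complexity.CircuitDAG
import Literature.GroupTheory.PermutationGroups.SmallIndexSubgroups
import HarnessLib

/-!
# The Support Theorem for reduced symmetric circuits
# (Dawar–Wilsenach, *Symmetric circuits for rank logic*, ACM ToCL 2021/22, §4, Theorem 4.10)

Everything PROVED; no named facts.  Printed statement (`[cite: DawarWilsenach2021, §4 Thm
(support-theorem)]`): *Let `C` be an injective symmetric circuit with unique extensions of order
`n > 8`. For every `1 ≤ k ≤ n/4`, if `ORB(C) < C(n, k)` then `SP(C) < k`* — every gate has a
support of size less than `k`.  In the source, "injective" means injective LABELS (its Def. 3.14)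
— here the hypothesis `hinj : ∀ l, Injective (E.args l)` (simple wiring) — and "unique
extensions" is rigidity (`GateDAG.IsRigidDAG`).  THIS FILE PROVES THE PRINTED THEOREM SPECIALISED
TO REDUCED DAGs (`GateDAG.Reduced`, the source's Def. 3.13 "reduced": no two gates with the same
gate function and the same multiset of arguments); reduced DAGs have unique extensions
(`Reduced.isRigidDAG`), but the merely-rigid case of the printed statement is NOT covered here (the
proof below uses reducedness, in `mem_stab_of_F_mem_args`, to identify the stabiliser of a gate
with the stabiliser of its set of argument wires).  In particular the hypothesis `hsupp` of
`Literature.ModelTheory.FiniteModelTheory.DawarWilsenach2025_supportSize_littleO_of_supportTheorem`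
(stated for all rigid circuits, `Circuit.IsRigid`) is NOT what is proved here; the discharge of
`DawarWilsenach2025_orbitSize_countingWidth` runs the printed argument on the reduced circuits
produced by `GateDAG.reduce` instead.

Setting and shape: DAG circuits (`GateDAG`) on matrix inputs `Fin m × Fin m` that are reduced,
simply wired and `Sym(Fin m)`-symmetric; if the orbit of every gate has at most `C(m, k)` elements,
`1 ≤ k`, `k + 1 ≤ m/4`, `m > 8`, then every gate `l` has a set `S` of at most `k` indices such that
every automorphism over a permutation fixing `S` pointwise fixes `l`
(`GateDAG.exists_support_of_orbit_le_choose`); and the same for the compiled straight-line program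
in terms of `Circuit.Supports` (`GateDAG.compile_supports`).  (The printed strict bounds
`ORB < C(n,k) ⇒ SP < k` are applied with `k + 1`: `ORB ≤ C(n, k) < C(n, k+1)`.)

## Proof (as printed, `sections/symmetry-and-support.tex` of arXiv:1804.02939)

By rigidity the automorphisms give an action of `Sym(Fin m)` on the gates; the stabiliser of `l`
has index `|Orb(l)| ≤ C(m, k) < C(m, k+1)`, so by Dixon–Mortimer Thm 5.2B
(`alternating_fixing_le_of_index_lt_choose`) some `X` with `|X| ≤ k` has all EVEN permutations
fixing `X` pointwise in the stabiliser.  If some transposition outside `X` stabilises `l` we are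
done (it generates, with those even permutations, all permutations fixing `X`).  Otherwise take
`a ≠ b` outside `X`: `(a b)` moves `l`, so — the circuit being reduced — the relabelling by
`(a b)` does not map the (injective) argument list of `l` into itself: some argument wire `w` is
sent outside it.  By induction along the wires `w` has a support `T` of size `≤ k` (an input wire
`(u, v)` is supported by `{u, v}`), and `(a b) w` is supported by `(a b) T`; as `|X| + 2k + 2 ≤ m`
(`k + 6 ≤ m` when `k = 1`) there are `c ≠ d` outside `X ∪ T ∪ (a b) T`, and `(c d)` fixes both `w`
and `(a b) w`.  Then `(a b)(c d)` is even and fixes `X`, hence stabilises `l` and permutes its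
argument wires — but it sends `w` to `(a b) w`, which is not one of them.

## References

* A. Dawar, G. Wilsenach, *Symmetric circuits for rank logic*, ACM Trans. Comput. Logic 23(1),
  Art. 6 (2021/2022) [DawarWilsenach2021], §4: Lemma (witness), Theorem (Support Theorem), with
  Dixon–Mortimer Thm 5.2B.  (Dawar–Wilsenach 2025, Thm 6.2 = `[16, Thm 4.10]`.)
-/

namespace Literature.Computability.Complexity

namespace GateDAG

open Finset Function

variable {m : ℕ} {Λ : Type*} (E : GateDAG (Fin m × Fin m) Λ)

/-- The diagonal map of a permutation on matrix inputs. [folklore] -/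
def dg (ρ : Equiv.Perm (Fin m)) : Fin m × Fin m → Fin m × Fin m := fun q => (ρ q.1, ρ q.2)

/-- Diagonal maps compose. [folklore] -/
theorem dg_mul (ρ ρ' : Equiv.Perm (Fin m)) : dg (ρ * ρ') = dg ρ ∘ dg ρ' := rfl

/-- The diagonal map of the identity. [folklore] -/
theorem dg_one : dg (1 : Equiv.Perm (Fin m)) = _root_.id := rfl

section Action

variable (hS : E.IsSymm (diagMaps Set.univ)) (hR : E.Reduced)

/-- The automorphism over (the diagonal map of) `ρ`, for a symmetric DAG. [folklore] -/
noncomputable def aut (ρ : Equiv.Perm (Fin m)) : Λ ≃ Λ :=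
  (hS (dg ρ) (diag_mem_diagMaps (Set.mem_univ ρ))).choose

/-- `aut ρ` is an automorphism over `dg ρ`. [folklore] -/
theorem aut_isAut (ρ : Equiv.Perm (Fin m)) : E.IsAut (dg ρ) (E.aut hS ρ) :=
  (hS (dg ρ) (diag_mem_diagMaps (Set.mem_univ ρ))).choose_spec

include hR in
/-- Uniqueness: every automorphism over `dg ρ` is `aut ρ` (reduced DAGs are rigid). [folklore] -/
theorem eq_aut {ρ : Equiv.Perm (Fin m)} {θ : Λ ≃ Λ} (h : E.IsAut (dg ρ) θ) : θ = E.aut hS ρ :=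
  h.unique E hR (E.aut_isAut hS ρ)

include hR in
/-- **The action**: `aut (ρ ρ') = aut ρ ∘ aut ρ'`. [folklore] -/
theorem aut_mul (ρ ρ' : Equiv.Perm (Fin m)) : E.aut hS (ρ * ρ') = E.aut hS ρ * E.aut hS ρ' := by
  symm
  apply E.eq_aut hS hR
  rw [dg_mul]
  exact (E.aut_isAut hS ρ').trans E (E.aut_isAut hS ρ)

include hR in
/-- `aut 1 = 1`. [folklore] -/
theorem aut_one : E.aut hS 1 = 1 := by
  symm; apply E.eq_aut hS hR
  rw [dg_one]; exact E.isAut_id_refl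

/-- The action as a homomorphism `Sym(Fin m) → Sym(Λ)`. [folklore] -/
noncomputable def autHom : Equiv.Perm (Fin m) →* Equiv.Perm Λ where
  toFun := E.aut hS
  map_one' := E.aut_one hS hR
  map_mul' := E.aut_mul hS hR

/-- The relabelling of wires by `ρ`. [folklore] -/
noncomputable def F (ρ : Equiv.Perm (Fin m)) : (Fin m × Fin m) ⊕ Λ → (Fin m × Fin m) ⊕ Λ :=
  Sum.map (dg ρ) (E.aut hS ρ)

include hR in
/-- Relabelling is an action. [folklore] -/
theorem F_mul (ρ ρ' : Equiv.Perm (Fin m)) (w : (Fin m × Fin m) ⊕ Λ) :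
    E.F hS (ρ * ρ') w = E.F hS ρ (E.F hS ρ' w) := by
  cases w with
  | inl q => rfl
  | inr l => simp [F, E.aut_mul hS hR]

/-- The stabiliser of a gate. [cite: DawarWilsenach2021, §4 (Stab_n(g))] -/
noncomputable def stab (l : Λ) : Subgroup (Equiv.Perm (Fin m)) where
  carrier := {ρ | E.aut hS ρ l = l}
  one_mem' := by show E.aut hS 1 l = l; rw [E.aut_one hS hR]; rfl
  mul_mem' := by
    intro ρ ρ' hρ hρ'
    show E.aut hS (ρ * ρ') l = l
    rw [E.aut_mul hS hR, Equiv.Perm.mul_apply, hρ', hρ]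
  inv_mem' := by
    intro ρ hρ
    show E.aut hS ρ⁻¹ l = l
    have : E.aut hS (ρ⁻¹ * ρ) l = l := by rw [inv_mul_cancel, E.aut_one hS hR]; rfl
    rw [E.aut_mul hS hR, Equiv.Perm.mul_apply] at this
    conv_lhs => rw [← hρ]
    exact this

/-- Membership in the stabiliser. [folklore] -/
theorem mem_stab_iff (l : Λ) (ρ : Equiv.Perm (Fin m)) : ρ ∈ E.stab hS hR l ↔ E.aut hS ρ l = l := Iff.rfl

/-- **Orbit–stabiliser**: the index of the stabiliser is the size of the orbit under all diagonal
maps. [folklore] -/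
theorem index_stab (l : Λ) : (E.stab hS hR l).index = (E.orbit (diagMaps Set.univ) l).ncard := by
  letI : MulAction (Equiv.Perm (Fin m)) Λ := MulAction.compHom Λ (E.autHom hS hR)
  have hstab : E.stab hS hR l = MulAction.stabilizer (Equiv.Perm (Fin m)) l := by
    ext ρ; rfl
  have horb : E.orbit (diagMaps Set.univ) l = MulAction.orbit (Equiv.Perm (Fin m)) l := by
    ext l'
    rw [E.mem_orbit_iff, MulAction.mem_orbit_iff]
    constructor
    · rintro ⟨π, ⟨ρ, -, rfl⟩, θ, hθ, rfl⟩
      exact ⟨ρ, by rw [E.eq_aut hS hR (θ := θ) hθ]; rfl⟩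
    · rintro ⟨ρ, rfl⟩
      exact ⟨_, diag_mem_diagMaps (Set.mem_univ ρ), _, E.aut_isAut hS ρ, rfl⟩
  rw [hstab, horb, MulAction.index_stabilizer]

/-- A stabilising `ρ` permutes the argument wires of `l`: `F ρ` maps them into themselves.
[cite: DawarWilsenach2021, §4 Lemma (witness), ⇒] -/
theorem F_mem_args_of_mem_stab {l : Λ} {ρ : Equiv.Perm (Fin m)} (hρ : ρ ∈ E.stab hS hR l)
    (a : Fin (E.fn l).1) : ∃ a', E.args l a' = E.F hS ρ (E.args l a) := by
  have hperm := (E.aut_isAut hS ρ).args_perm l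
  rw [(E.mem_stab_iff hS hR l ρ).1 hρ] at hperm
  have hmem : E.F hS ρ (E.args l a) ∈ (List.ofFn (E.args l)).map (Sum.map (dg ρ) (E.aut hS ρ)) :=
    List.mem_map.2 ⟨E.args l a, by simp [List.mem_ofFn], rfl⟩
  rw [← hperm.mem_iff, List.mem_ofFn] at hmem
  obtain ⟨a', ha'⟩ := hmem
  exact ⟨a', ha'⟩

/-- Conversely (reduced DAG, injective wiring): if `F ρ` maps the argument wires of `l` into
themselves then `ρ` stabilises `l`. [cite: DawarWilsenach2021, §4 Lemma (witness), ⇐] -/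
theorem mem_stab_of_F_mem_args (hinj : ∀ l, Injective (E.args l)) {l : Λ} {ρ : Equiv.Perm (Fin m)}
    (h : ∀ a, ∃ a', E.args l a' = E.F hS ρ (E.args l a)) : ρ ∈ E.stab hS hR l := by
  rw [mem_stab_iff]
  -- `args (aut ρ l) ~ (args l).map (F ρ) ~ args l`, so reducedness gives `aut ρ l = l`
  have hA := E.aut_isAut hS ρ
  apply hR
  · exact hA.fn_eq l
  · refine (hA.args_perm l).trans ?_
    -- both lists are duplicate-free with the same members
    have hnd1 : ((List.ofFn (E.args l)).map (Sum.map (dg ρ) (E.aut hS ρ))).Nodup := by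
      refine (List.nodup_ofFn_ofInjective (hinj l)).map ?_
      exact Sum.map_injective.2 ⟨fun q q' hq => by
        simp only [dg, Prod.mk.injEq] at hq
        exact Prod.ext (ρ.injective hq.1) (ρ.injective hq.2), (E.aut hS ρ).injective⟩
    have hnd2 : (List.ofFn (E.args l)).Nodup := List.nodup_ofFn_ofInjective (hinj l)
    rw [List.perm_ext_iff_of_nodup hnd1 hnd2]
    -- the image set is contained in the argument set and has the same size
    have hsub : ∀ w, w ∈ (List.ofFn (E.args l)).map (Sum.map (dg ρ) (E.aut hS ρ)) → w ∈ List.ofFn (E.args l) := by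
      intro w hw
      rw [List.mem_map] at hw
      obtain ⟨w', hw', rfl⟩ := hw
      rw [List.mem_ofFn] at hw' ⊢
      obtain ⟨a, rfl⟩ := hw'
      obtain ⟨a', ha'⟩ := h a
      exact ⟨a', ha'⟩
    intro w
    refine ⟨hsub w, fun hw => ?_⟩
    -- counting: an injection of a finite set into itself is onto
    have hlen : ((List.ofFn (E.args l)).map (Sum.map (dg ρ) (E.aut hS ρ))).length = (List.ofFn (E.args l)).length := by
      simp
    have hsubperm : ((List.ofFn (E.args l)).map (Sum.map (dg ρ) (E.aut hS ρ))).Subperm (List.ofFn (E.args l)) :=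
      hnd1.subperm hsub
    have hperm : ((List.ofFn (E.args l)).map (Sum.map (dg ρ) (E.aut hS ρ))).Perm (List.ofFn (E.args l)) :=
      hsubperm.perm_of_length_le (by rw [hlen])
    exact hperm.mem_iff.2 hw

/-- **Supports of wires.**  A finite set `T` SUPPORTS the wire `w` if every relabelling by a
permutation fixing `T` pointwise fixes `w`. [cite: DawarWilsenach2021, §4 (supports)] -/
def WSupp (T : Finset (Fin m)) (w : (Fin m × Fin m) ⊕ Λ) : Prop :=
  ∀ ρ : Equiv.Perm (Fin m), (∀ i ∈ T, ρ i = i) → E.F hS ρ w = w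

/-- An input wire `(u, v)` is supported by `{u, v}`. [folklore] -/
theorem wsupp_inl (q : Fin m × Fin m) : E.WSupp hS {q.1, q.2} (Sum.inl q) := by
  intro ρ hρ
  simp only [F, Sum.map_inl, dg, Sum.inl.injEq]
  exact Prod.ext (hρ _ (by simp)) (hρ _ (by simp))

include hR in
/-- **Transport of supports**: if `T` supports `w` then `τ T` supports `F τ w`. [folklore] -/
theorem wsupp_image {T : Finset (Fin m)} {w : (Fin m × Fin m) ⊕ Λ} (h : E.WSupp hS T w)
    (τ : Equiv.Perm (Fin m)) : E.WSupp hS (T.image τ) (E.F hS τ w) := by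
  intro ρ hρ
  -- `τ⁻¹ ρ τ` fixes `T`
  have hfix : ∀ i ∈ T, (τ⁻¹ * ρ * τ) i = i := by
    intro i hi
    have := hρ (τ i) (Finset.mem_image_of_mem τ hi)
    simp only [Equiv.Perm.mul_apply, this]
    simp
  have := h _ hfix
  calc E.F hS ρ (E.F hS τ w) = E.F hS (ρ * τ) w := (E.F_mul hS hR _ _ _).symm
    _ = E.F hS (τ * (τ⁻¹ * ρ * τ)) w := by rw [show τ * (τ⁻¹ * ρ * τ) = ρ * τ from by group]
    _ = E.F hS τ (E.F hS (τ⁻¹ * ρ * τ) w) := E.F_mul hS hR _ _ _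
    _ = E.F hS τ w := by rw [this]

end Action

/-- Strict growth of the binomials below the middle: `C(n, k) < C(n, k+1)` for `2k + 1 < n`.
[folklore] -/
theorem choose_lt_choose_succ {n k : ℕ} (h : 2 * k + 1 < n) : n.choose k < n.choose (k + 1) := by
  have h1 : n.choose (k + 1) * (k + 1) = n.choose k * (n - k) := Nat.choose_succ_right_eq n k
  have hpos : 0 < n.choose k := Nat.choose_pos (by omega)
  by_contra hle
  push Not at hle
  have : n.choose k * (n - k) ≤ n.choose k * (k + 1) := by
    rw [← h1]; exact Nat.mul_le_mul_right _ hle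
  have := Nat.le_of_mul_le_mul_left this hpos
  omega

/-- Two points outside three small finsets. [folklore] -/
theorem exists_two_not_mem {m : ℕ} (A B C : Finset (Fin m)) (h : A.card + B.card + C.card + 2 ≤ m) :
    ∃ c d : Fin m, c ≠ d ∧ c ∉ A ∧ c ∉ B ∧ c ∉ C ∧ d ∉ A ∧ d ∉ B ∧ d ∉ C := by
  have hc : 2 ≤ ((A ∪ B ∪ C)ᶜ).card := by
    rw [Finset.card_compl, Fintype.card_fin]
    have := (Finset.card_union_le (A ∪ B) C).trans (Nat.add_le_add_right (Finset.card_union_le A B) _)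
    omega
  obtain ⟨c, hc, d, hd, hcd⟩ := Finset.one_lt_card.1 hc
  simp only [Finset.mem_compl, Finset.mem_union, not_or] at hc hd
  exact ⟨c, d, hcd, hc.1.1, hc.1.2, hc.2, hd.1.1, hd.1.2, hd.2⟩

/-- **The Support Theorem (Dawar–Wilsenach 2021, §4, Thm 4.10) SPECIALISED TO REDUCED DAGs** —
reduced (source Def. 3.13; implies the printed "unique extensions"), simply wired (= the printed
"injective", Def. 3.14: injective labels), `Sym(Fin m)`-symmetric DAG circuits on matrix inputs; the
merely-rigid case of the printed statement is not covered: if every gate orbit has at most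
`C(m, k)` elements (`m > 8`, `1 ≤ k`, `k + 1 ≤ m/4`), then every gate `l` has a support of size at
most `k` — a set `S` such that every automorphism over (the diagonal map of) a permutation fixing
`S` pointwise fixes `l`. [cite: DawarWilsenach2021, §4 Thm (support-theorem), via DixonMortimer1996 Thm 5.2B] -/
theorem exists_support_of_orbit_le_choose (hR : E.Reduced) (hS : E.IsSymm (diagMaps Set.univ))
    (hinj : ∀ l, Injective (E.args l)) (hm : 8 < m) {k : ℕ} (hk : 1 ≤ k) (hk4 : k + 1 ≤ m / 4)
    (horb : ∀ l, (E.orbit (diagMaps Set.univ) l).ncard ≤ m.choose k) :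
    ∀ l, ∃ S : Finset (Fin m), S.card ≤ k ∧
      ∀ ρ : Equiv.Perm (Fin m), (∀ i ∈ S, ρ i = i) → ∀ θ : Λ ≃ Λ, E.IsAut (dg ρ) θ → θ l = l := by
  -- it suffices to produce supports for the chosen automorphisms `aut ρ`
  suffices hmain : ∀ l, ∃ S : Finset (Fin m), S.card ≤ k ∧ ∀ ρ : Equiv.Perm (Fin m), (∀ i ∈ S, ρ i = i) → E.aut hS ρ l = l by
    intro l
    obtain ⟨S, hS', h⟩ := hmain l
    exact ⟨S, hS', fun ρ hρ θ hθ => by rw [E.eq_aut hS hR hθ]; exact h ρ hρ⟩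
  intro l
  induction l using E.wf.induction with
  | _ l ih =>
    -- Dixon–Mortimer with `k + 1`
    have hidx : (E.stab hS hR l).index < (Fintype.card (Fin m)).choose (k + 1) := by
      rw [E.index_stab hS hR, Fintype.card_fin]
      exact (horb l).trans_lt (choose_lt_choose_succ (by omega))
    obtain ⟨X, hXk, hDM⟩ :=
      Literature.GroupTheory.PermutationGroups.alternating_fixing_le_of_index_lt_choose
        (E.stab hS hR l) (k + 1) (by rwa [Fintype.card_fin]) (by omega) (by rw [Fintype.card_fin]; omega) hidx
    refine ⟨X, by omega, ?_⟩
    -- it suffices to find ONE transposition outside `X` in the stabiliser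
    suffices hsw : ∃ a b : Fin m, a ≠ b ∧ a ∉ X ∧ b ∉ X ∧ Equiv.swap a b ∈ E.stab hS hR l by
      obtain ⟨a, b, hab, haX, hbX, hswap⟩ := hsw
      intro ρ hρ
      rw [← E.mem_stab_iff hS hR]
      by_cases hsign : Equiv.Perm.sign ρ = 1
      · exact hDM ρ hρ hsign
      · -- `ρ (a b)` is even and fixes `X`
        have h1 : ρ * Equiv.swap a b ∈ E.stab hS hR l := by
          refine hDM _ (fun x hx => ?_) ?_
          · rw [Equiv.Perm.mul_apply, Equiv.swap_apply_of_ne_of_ne (by rintro rfl; exact haX hx)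
              (by rintro rfl; exact hbX hx), hρ x hx]
          · rw [map_mul, Equiv.Perm.sign_swap hab]
            rcases Int.units_eq_one_or (Equiv.Perm.sign ρ) with h | h
            · exact absurd h hsign
            · rw [h]; rfl
        have := (E.stab hS hR l).mul_mem h1 hswap
        rwa [mul_assoc, Equiv.swap_mul_self, mul_one] at this
    -- suppose not; take two points outside `X`
    by_contra hno
    push Not at hno
    have hX2 : X.card + 2 ≤ m := by omega
    obtain ⟨a, b, hab, haX, -, -, hbX, -, -⟩ := exists_two_not_mem X ∅ ∅ (by simpa using hX2)
    set τ := Equiv.swap a b with hτ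
    have hτl : τ ∉ E.stab hS hR l := hno a b hab haX hbX
    -- some argument wire of `l` is sent outside the argument wires by `F τ`
    have hw : ∃ a₀, ∀ a', E.args l a' ≠ E.F hS τ (E.args l a₀) := by
      by_contra hall
      push Not at hall
      exact hτl (E.mem_stab_of_F_mem_args hS hR hinj fun a₀ => by
        obtain ⟨a', ha'⟩ := hall a₀; exact ⟨a', ha'⟩)
    obtain ⟨a₀, ha₀⟩ := hw
    set w := E.args l a₀ with hw_def
    -- a support `T` of `w`, of size `≤ max k 2`
    have hT : ∃ T : Finset (Fin m), T.card ≤ max k 2 ∧ E.WSupp hS T w := by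
      rw [hw_def]
      cases hwa : E.args l a₀ with
      | inl q =>
        refine ⟨{q.1, q.2}, ?_, E.wsupp_inl hS q⟩
        exact (Finset.card_insert_le _ _).trans (by simp)
      | inr c =>
        obtain ⟨Sc, hSck, hSc⟩ := ih c ⟨a₀, hwa⟩
        refine ⟨Sc, hSck.trans (le_max_left _ _), fun ρ hρ => ?_⟩
        simp only [F, Sum.map_inr, hSc ρ hρ]
    obtain ⟨T, hTcard, hTw⟩ := hT
    have hTw' := E.wsupp_image hS hR hTw τ
    -- two fresh points
    have hroom : X.card + T.card + (T.image τ).card + 2 ≤ m := by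
      have h1 : (T.image τ).card ≤ T.card := Finset.card_image_le
      have h2 : max k 2 ≤ k + 1 := by omega
      have : X.card + 2 * (k + 1) + 2 ≤ m := by omega
      omega
    obtain ⟨c, d, hcd, hcX, hcT, hcT', hdX, hdT, hdT'⟩ := exists_two_not_mem X T (T.image τ) hroom
    set π := Equiv.swap c d with hπ
    have hπw : E.F hS π w = w :=
      hTw π fun i hi => Equiv.swap_apply_of_ne_of_ne (by rintro rfl; exact hcT hi) (by rintro rfl; exact hdT hi)
    have hπw' : E.F hS π (E.F hS τ w) = E.F hS τ w :=
      hTw' π fun i hi => Equiv.swap_apply_of_ne_of_ne (by rintro rfl; exact hcT' hi) (by rintro rfl; exact hdT' hi)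
    -- `τ π` is even, fixes `X`, hence stabilises `l`
    have hτπ : τ * π ∈ E.stab hS hR l := by
      refine hDM _ (fun x hx => ?_) ?_
      · have hπx : π x = x :=
          Equiv.swap_apply_of_ne_of_ne (fun h => hcX (h ▸ hx)) (fun h => hdX (h ▸ hx))
        have hτx : τ x = x :=
          Equiv.swap_apply_of_ne_of_ne (fun h => haX (h ▸ hx)) (fun h => hbX (h ▸ hx))
        rw [Equiv.Perm.mul_apply, hπx, hτx]
      · rw [map_mul, hτ, hπ, Equiv.Perm.sign_swap hab, Equiv.Perm.sign_swap hcd]; rfl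
    -- but it sends `w` outside the argument wires
    obtain ⟨a', ha'⟩ := E.F_mem_args_of_mem_stab hS hR hτπ a₀
    rw [E.F_mul hS hR, ← hw_def, hπw] at ha'
    exact ha₀ a' ha'

/-! ### The compiled program -/

/-- **The Support Theorem for the compiled program** of a REDUCED (source Def. 3.13), simply
wired (printed "injective"), `Sym(Fin m)`-symmetric DAG on matrix inputs — the reduced special
case of the printed theorem, which assumes only unique extensions — in terms of
`Circuit.Supports`: if the orbit size is at most `C(m, k)` (`m > 8`, `1 ≤ k`, `k + 1 ≤ m/4`),
every gate has a support of size at most `k`. [cite: DawarWilsenach2021, §4 Thm (support-theorem)] -/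
theorem compile_supports [Fintype Λ] (hR : E.Reduced) (hS : E.IsSymm (diagMaps Set.univ))
    (hinj : ∀ l, Injective (E.args l)) (hm : 8 < m) {k : ℕ} (hk : 1 ≤ k) (hk4 : k + 1 ≤ m / 4)
    (horb : E.compile.orbitSize Set.univ ≤ m.choose k) :
    ∀ j : Fin E.compile.gates.length, ∃ S : Finset (Fin m), S.card ≤ k ∧
      E.compile.Supports Set.univ (S : Set (Fin m)) j := by
  intro j
  have horb' : ∀ l, (E.orbit (diagMaps Set.univ) l).ncard ≤ m.choose k := by
    intro l
    rw [← E.ncard_gateOrbit_compile]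
    exact (E.compile.ncard_gateOrbit_le_orbitSize _ _).trans horb
  obtain ⟨S, hSk, hsupp⟩ := E.exists_support_of_orbit_le_choose hR hS hinj hm hk hk4 horb' (E.posC.symm j)
  refine ⟨S, hSk, fun ρ _ hρ => ⟨Set.mem_univ ρ, ?_⟩⟩
  obtain ⟨θ, hθ⟩ := hS _ (diag_mem_diagMaps (Set.mem_univ ρ))
  refine ⟨_, hθ.isInducedAut_compile, ?_⟩
  have := hsupp ρ hρ θ hθ
  simp [this]

end GateDAG


end Literature.Computability.Complexity
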